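import Summits.CriticalPhenomena.PercolationContinuityZ3.Theorems.PercNearOneGluingNoHeavyLowerTailChampionStabilityLevelOneRows
import HarnessLib

/-!
# `NoHeavyLowerTail` (stmt-CriticalPhenomena-4575) — champion stability for vertex pairs at LEVEL ONE (assembly)

Seat `prim-gen-swap`, 2026-08-18.  The `j = 1` instance of the registered stub `stub_championStabilityPair`, unconditional:
if `c ∈ A` maximises `μ(|π(·)| ≤ 1)` over `A`, then for all vertices `x, y`
`μ(c ↮ x, c ↮ y, |π(x) ∪ π(y)| = 1) ≤ μ(c ↮ x, c ↮ y, |π(c)| ≤ 1)`.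
The chain (rows, packing, champion slack) is `CSLevelOne.le_of_lt` in `…ChampionStabilityLevelOneRows` (all weights `< 1`);
this file removes the restriction on the weights by the continuity of `w ↦ μ_w(E)` (`stub_weightContinuity`) along
`w_k = (1 - 1/(k+1)) w → w`, the champion hypothesis at `w` giving a vanishing slack `η_k` at `w_k`.
-/

noncomputable section

namespace Summit.CriticalPhenomena.PercolationContinuityZ3.Theorems

open scoped BigOperators Classical Topology
open MeasureTheory Set Filter
open Literature.Probability.LatticeModels (prodBernoulli)
open Literature.Probability.Percolation

variable {n : ℕ}

open CSLevelOne in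
/-- **Champion stability for vertex pairs at level `j = 1`** (the `j = 1` instance of the registered stub
`stub_championStabilityPair`; no hypothesis on `x`): if `c ∈ A` maximises `μ(|π(·)| ≤ 1)` over `A`, then
`μ(c ↮ x, c ↮ y, |π(x) ∪ π(y)| = 1) ≤ μ(c ↮ x, c ↮ y, |π(c)| ≤ 1)`.
[cite: KozmaNitzan2024, Lemmas 1–2 (pp. 5–6); VandenbergHaggstromKahn2005, Thm. 1.3] -/
theorem championStabilityPair_level_one (w : Sym2 (Fin n) → unitInterval) (A : Finset (Fin n))
    (x y c : Fin n) (hc : c ∈ A)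
    (hchamp : ∀ a ∈ A,
      (prodBernoulli w).real {ω : BondConfig (Fin n) | (A.filter fun z => ω ∈ openConn a z).card ≤ 1} ≤
        (prodBernoulli w).real {ω : BondConfig (Fin n) | (A.filter fun z => ω ∈ openConn c z).card ≤ 1}) :
    (prodBernoulli w).real {ω : BondConfig (Fin n) | ω ∉ openConn c x ∧ ω ∉ openConn c y ∧
        1 ≤ (A.filter fun z => ω ∈ openConn x z ∨ ω ∈ openConn y z).card ∧
        (A.filter fun z => ω ∈ openConn x z ∨ ω ∈ openConn y z).card ≤ 1} ≤
      (prodBernoulli w).real {ω : BondConfig (Fin n) | ω ∉ openConn c x ∧ ω ∉ openConn c y ∧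
        (A.filter fun z => ω ∈ openConn c z).card ≤ 1} := by
  -- rewrite the right event and the champion hypothesis through `D`
  have hR : {ω : BondConfig (Fin n) | ω ∉ openConn c x ∧ ω ∉ openConn c y ∧
      (A.filter fun z => ω ∈ openConn c z).card ≤ 1} = ({ω : BondConfig (Fin n) | ∀ t ∈ A.erase c, ω ∉ openConn c t}) ∩ ({ω : BondConfig (Fin n) | ω ∉ openConn c x ∧ ω ∉ openConn c y}) := by
    ext ω
    have h := Set.ext_iff.1 (card_le_one_eq_Dsep A hc) ω
    simp only [mem_setOf_eq] at h
    simp only [mem_inter_iff, mem_setOf_eq] at h ⊢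
    tauto
  have hchamp' : ∀ b ∈ A, (prodBernoulli w).real (({ω : BondConfig (Fin n) | ∀ t ∈ A.erase b, ω ∉ openConn b t})) ≤ (prodBernoulli w).real (({ω : BondConfig (Fin n) | ∀ t ∈ A.erase c, ω ∉ openConn c t})) := by
    intro b hb
    have := hchamp b hb
    rwa [card_le_one_eq_Dsep A hb, card_le_one_eq_Dsep A hc] at this
  rw [hR]
  set L : Set (BondConfig (Fin n)) := {ω : BondConfig (Fin n) | ω ∉ openConn c x ∧ ω ∉ openConn c y ∧
      1 ≤ (A.filter fun z => ω ∈ openConn x z ∨ ω ∈ openConn y z).card ∧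
      (A.filter fun z => ω ∈ openConn x z ∨ ω ∈ openConn y z).card ≤ 1} with hLdef
  -- scaled weights `w_k = (1 - 1/(k+1)) • w`, all `< 1`, converging to `w`
  have hcmem : ∀ k : ℕ, ((1 : ℝ) - 1 / ((k : ℝ) + 1)) ∈ unitInterval := by
    intro k
    have hk : (0 : ℝ) < (k : ℝ) + 1 := Nat.cast_add_one_pos k
    have h1 : 1 / ((k : ℝ) + 1) ≤ 1 := by
      rw [div_le_one hk]; linarith [(Nat.cast_nonneg k : (0 : ℝ) ≤ k)]
    have h0 : 0 ≤ 1 / ((k : ℝ) + 1) := by positivity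
    exact ⟨by linarith, by linarith⟩
  set wk : ℕ → Sym2 (Fin n) → unitInterval :=
    fun k e => ⟨(1 - 1 / ((k : ℝ) + 1)) * (w e : ℝ), unitInterval.mul_mem (hcmem k) (w e).2⟩
    with hwk_def
  have hwk_lt : ∀ k e, ((wk k e : unitInterval) : ℝ) < 1 := by
    intro k e
    have hk : (0 : ℝ) < (k : ℝ) + 1 := Nat.cast_add_one_pos k
    have hc1 : (1 : ℝ) - 1 / ((k : ℝ) + 1) < 1 := by
      have : 0 < 1 / ((k : ℝ) + 1) := by positivity
      linarith
    calc ((wk k e : unitInterval) : ℝ) = (1 - 1 / ((k : ℝ) + 1)) * (w e : ℝ) := rfl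
      _ ≤ (1 - 1 / ((k : ℝ) + 1)) := mul_le_of_le_one_right (hcmem k).1 (w e).2.2
      _ < 1 := hc1
  have hc_lim : Tendsto (fun k : ℕ => (1 : ℝ) - 1 / ((k : ℝ) + 1)) atTop (𝓝 1) := by
    simpa using tendsto_const_nhds.sub (tendsto_one_div_add_atTop_nhds_zero_nat (𝕜 := ℝ))
  have hwk_lim : Tendsto wk atTop (𝓝 w) := by
    refine tendsto_pi_nhds.2 fun e => ?_
    rw [tendsto_subtype_rng]
    have h := hc_lim.mul_const (w e : ℝ)
    rw [one_mul] at h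
    exact h
  have hlimE : ∀ E : Set (Set (Sym2 (Fin n))),
      Tendsto (fun k => (prodBernoulli (wk k)).real E) atTop (𝓝 ((prodBernoulli w).real E)) :=
    fun E => ((stub_weightContinuity n E).tendsto w).comp hwk_lim
  -- champion slack at `w_k`
  set η : ℕ → ℝ := fun k => ∑ b ∈ A,
      (|(prodBernoulli (wk k)).real (({ω : BondConfig (Fin n) | ∀ t ∈ A.erase b, ω ∉ openConn b t})) - (prodBernoulli w).real (({ω : BondConfig (Fin n) | ∀ t ∈ A.erase b, ω ∉ openConn b t}))| +
        |(prodBernoulli (wk k)).real (({ω : BondConfig (Fin n) | ∀ t ∈ A.erase c, ω ∉ openConn c t})) - (prodBernoulli w).real (({ω : BondConfig (Fin n) | ∀ t ∈ A.erase c, ω ∉ openConn c t}))|) with hη_def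
  have hη0 : ∀ k, 0 ≤ η k := fun k => Finset.sum_nonneg fun b _ => by positivity
  have hη_lim : Tendsto η atTop (𝓝 0) := by
    have h : ∀ b ∈ A, Tendsto (fun k =>
        |(prodBernoulli (wk k)).real (({ω : BondConfig (Fin n) | ∀ t ∈ A.erase b, ω ∉ openConn b t})) - (prodBernoulli w).real (({ω : BondConfig (Fin n) | ∀ t ∈ A.erase b, ω ∉ openConn b t}))| +
          |(prodBernoulli (wk k)).real (({ω : BondConfig (Fin n) | ∀ t ∈ A.erase c, ω ∉ openConn c t})) - (prodBernoulli w).real (({ω : BondConfig (Fin n) | ∀ t ∈ A.erase c, ω ∉ openConn c t}))|) atTop (𝓝 0) := by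
      intro b _
      have h1 := (tendsto_sub_nhds_zero_iff.2 (hlimE (({ω : BondConfig (Fin n) | ∀ t ∈ A.erase b, ω ∉ openConn b t})))).abs
      have h2 := (tendsto_sub_nhds_zero_iff.2 (hlimE (({ω : BondConfig (Fin n) | ∀ t ∈ A.erase c, ω ∉ openConn c t})))).abs
      simpa using h1.add h2
    simpa [hη_def] using tendsto_finsetSum A h
  have hchampk : ∀ k, ∀ b ∈ A, (prodBernoulli (wk k)).real (({ω : BondConfig (Fin n) | ∀ t ∈ A.erase b, ω ∉ openConn b t})) ≤
      (prodBernoulli (wk k)).real (({ω : BondConfig (Fin n) | ∀ t ∈ A.erase c, ω ∉ openConn c t})) + η k := by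
    intro k b hb
    have h0 := hchamp' b hb
    have hb1 : |(prodBernoulli (wk k)).real (({ω : BondConfig (Fin n) | ∀ t ∈ A.erase b, ω ∉ openConn b t})) - (prodBernoulli w).real (({ω : BondConfig (Fin n) | ∀ t ∈ A.erase b, ω ∉ openConn b t}))| +
        |(prodBernoulli (wk k)).real (({ω : BondConfig (Fin n) | ∀ t ∈ A.erase c, ω ∉ openConn c t})) - (prodBernoulli w).real (({ω : BondConfig (Fin n) | ∀ t ∈ A.erase c, ω ∉ openConn c t}))| ≤ η k :=
      Finset.single_le_sum (f := fun b =>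
        |(prodBernoulli (wk k)).real (({ω : BondConfig (Fin n) | ∀ t ∈ A.erase b, ω ∉ openConn b t})) - (prodBernoulli w).real (({ω : BondConfig (Fin n) | ∀ t ∈ A.erase b, ω ∉ openConn b t}))| +
          |(prodBernoulli (wk k)).real (({ω : BondConfig (Fin n) | ∀ t ∈ A.erase c, ω ∉ openConn c t})) - (prodBernoulli w).real (({ω : BondConfig (Fin n) | ∀ t ∈ A.erase c, ω ∉ openConn c t}))|)
        (fun b _ => by positivity) hb
    have h3 := le_abs_self ((prodBernoulli (wk k)).real (({ω : BondConfig (Fin n) | ∀ t ∈ A.erase b, ω ∉ openConn b t})) - (prodBernoulli w).real (({ω : BondConfig (Fin n) | ∀ t ∈ A.erase b, ω ∉ openConn b t})))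
    have h4 := neg_abs_le ((prodBernoulli (wk k)).real (({ω : BondConfig (Fin n) | ∀ t ∈ A.erase c, ω ∉ openConn c t})) - (prodBernoulli w).real (({ω : BondConfig (Fin n) | ∀ t ∈ A.erase c, ω ∉ openConn c t})))
    linarith
  -- the bound at each `k`
  have hk : ∀ k, (prodBernoulli (wk k)).real L ≤
      (prodBernoulli (wk k)).real (({ω : BondConfig (Fin n) | ∀ t ∈ A.erase c, ω ∉ openConn c t}) ∩ ({ω : BondConfig (Fin n) | ω ∉ openConn c x ∧ ω ∉ openConn c y})) + η k :=
    fun k => le_of_lt (wk k) (hwk_lt k) A x y hc (η k) (hη0 k) (hchampk k)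
  -- pass to the limit
  have hlimL : Tendsto (fun k => (prodBernoulli (wk k)).real L) atTop (𝓝 ((prodBernoulli w).real L)) :=
    hlimE L
  have hlimR : Tendsto (fun k => (prodBernoulli (wk k)).real (({ω : BondConfig (Fin n) | ∀ t ∈ A.erase c, ω ∉ openConn c t}) ∩ ({ω : BondConfig (Fin n) | ω ∉ openConn c x ∧ ω ∉ openConn c y})) + η k) atTop
      (𝓝 ((prodBernoulli w).real (({ω : BondConfig (Fin n) | ∀ t ∈ A.erase c, ω ∉ openConn c t}) ∩ ({ω : BondConfig (Fin n) | ω ∉ openConn c x ∧ ω ∉ openConn c y})))) := by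
    simpa using (hlimE (({ω : BondConfig (Fin n) | ∀ t ∈ A.erase c, ω ∉ openConn c t}) ∩ ({ω : BondConfig (Fin n) | ω ∉ openConn c x ∧ ω ∉ openConn c y}))).add hη_lim
  exact le_of_tendsto_of_tendsto' hlimL hlimR hk

end Summit.CriticalPhenomena.PercolationContinuityZ3.Theorems

end
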